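import Literature.MathematicalPhysics.KineticTheory.InfiniteChainObservables
import Literature.MathematicalPhysics.KineticTheory.InfiniteChainPartialMomentumReversal
import Literature.MathematicalPhysics.KineticTheory.LangevinChainNESSProofs
import HarnessLib

/-!
# The odd part of a first-order invariant functional of the infinite chain
(crux `LocalOhmBV.LocalOhm`, item stmt-AtomisticToContinuum-12009, line `registered`/birth; helper 1/2 for the
rigidity stub `stub_oddSectorLiouville`; the reduction itself is `LocalOhmBVLocalOhmOddReduction.lean`)

The rigidity stub S3 of the line concerns functionals `Λ` on observables of `ChainConfig = ℤ → ℝ × ℝ`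
which are (1) linear on continuous polynomially bounded cylinder observables `g ∘ boxRestrictAt a n`,
(2) translation-uniformly `L²(μ)`-bounded on boxes (`μ` a DLR Gibbs state of the chain), (3) annihilate
`liouvilleZ P (G ∘ boxRestrictAt a n)` for `C¹` polynomially bounded `G`, and asks that such a `Λ`
carries no energy current, `Λ(j_0) = 0`.

This file proves that the momentum reversal `R = momentumReversalZ` (`(Rσ)_x = (q_x, -p_x)`) acts on
this class: the ODD PART `Λ⁻ f = (Λ f - Λ (f ∘ R))/2` again satisfies (1)–(3) (the Gibbs state is
`R`-invariant on every finite set of sites, `IsChainGibbsMeasure.map_momentumReversalOn`; the Liouville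
operator anti-commutes with `R`, `liouvilleZ_comp_momentumReversalZ`), is odd (`Λ⁻ (f ∘ R) = -Λ⁻ f`),
and agrees with `Λ` on cylinder observables that are odd under the reversal of the box momenta, such as
the bond currents of the pinned anharmonic chain (written out here as an explicit cylinder observable).
Consequently hypothesis (4) `Λ(p_i²) = 0` of the stub is idle (helper 2/2). No definitions: the reversal
of the box momenta is the explicit map `fun y i => ((y i).1, -(y i).2)`, identified inside proofs with
the Mathlib continuous linear equivalence `piCongrRight (refl × neg)`.
-/

set_option autoImplicit false

noncomputable section

namespace Summit.AtomisticToContinuum.FouriersLaw.Theorems.LocalOhmBirth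

open MeasureTheory Filter Topology
open scoped BigOperators
open Literature.MathematicalPhysics.KineticTheory.HeatConduction

/-! ## The reversal of the box momenta -/

/-- The reversal of the box momenta is the Mathlib continuous linear equivalence
`piCongrRight (refl × neg)` (as functions). -/
theorem boxRev_eq_coe (n : ℕ) :
    (fun (y : Fin (n + 1) → ℝ × ℝ) (i : Fin (n + 1)) => ((y i).1, -(y i).2)) =
      ⇑(ContinuousLinearEquiv.piCongrRight fun _ : Fin (n + 1) =>
        ContinuousLinearEquiv.prodCongr (ContinuousLinearEquiv.refl ℝ ℝ)
          (ContinuousLinearEquiv.neg ℝ : ℝ ≃L[ℝ] ℝ) :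
        (Fin (n + 1) → ℝ × ℝ) ≃L[ℝ] (Fin (n + 1) → ℝ × ℝ)) := by
  funext y i
  simp

/-- The reversal of the box momenta is an involution. -/
theorem boxRev_boxRev (n : ℕ) (y : Fin (n + 1) → ℝ × ℝ) :
    (fun i : Fin (n + 1) => (((fun i : Fin (n + 1) => ((y i).1, -(y i).2)) i).1,
      -((fun i : Fin (n + 1) => ((y i).1, -(y i).2)) i).2)) = y := by
  funext i
  simp

/-- The reversal of the box momenta preserves the (sup) norm. -/
theorem norm_boxRev (n : ℕ) (y : Fin (n + 1) → ℝ × ℝ) :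
    ‖(fun i : Fin (n + 1) => ((y i).1, -(y i).2))‖ = ‖y‖ := by
  have hle : ∀ z : Fin (n + 1) → ℝ × ℝ, ‖(fun i : Fin (n + 1) => ((z i).1, -(z i).2))‖ ≤ ‖z‖ := by
    intro z
    refine (pi_norm_le_iff_of_nonneg (norm_nonneg z)).2 fun i => ?_
    calc ‖((z i).1, -(z i).2)‖ = ‖z i‖ := by simp [Prod.norm_def]
      _ ≤ ‖z‖ := norm_le_pi_norm z i
  refine le_antisymm (hle y) ?_
  have h := hle (fun i : Fin (n + 1) => ((y i).1, -(y i).2))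
  rwa [boxRev_boxRev] at h

/-- Momentum reversal commutes with box restriction: `(Rσ)|_{box} = r(σ|_{box})`. -/
theorem boxRestrictAt_momentumReversalZ_eq (a : ℤ) (n : ℕ) (σ : ChainConfig) :
    boxRestrictAt a n (momentumReversalZ σ) =
      fun i : Fin (n + 1) => ((boxRestrictAt a n σ i).1, -(boxRestrictAt a n σ i).2) := by
  funext i
  simp [boxRestrictAt]

/-- Function-level form: `(g ∘ box) ∘ R = (g ∘ r) ∘ box`. -/
theorem comp_boxRestrictAt_comp_momentumReversalZ (a : ℤ) (n : ℕ) {α : Type*}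
    (g : (Fin (n + 1) → ℝ × ℝ) → α) :
    (g ∘ boxRestrictAt a n) ∘ momentumReversalZ =
      (fun y : Fin (n + 1) → ℝ × ℝ => g (fun i => ((y i).1, -(y i).2))) ∘ boxRestrictAt a n := by
  funext σ
  simp only [Function.comp_apply, boxRestrictAt_momentumReversalZ_eq]

/-- On the box sites the global reversal `R` and the partial reversal `R_S` of the sites
`S = {a, …, a+n}` agree after restriction. -/
theorem boxRestrictAt_momentumReversalOn_eq (a : ℤ) (n : ℕ) (σ : ChainConfig) :
    boxRestrictAt a n
        (momentumReversalOn (Finset.image (fun i : Fin (n + 1) => a + (i : ℤ)) Finset.univ) σ) =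
      fun i : Fin (n + 1) => ((boxRestrictAt a n σ i).1, -(boxRestrictAt a n σ i).2) := by
  funext i
  have hi : a + (i : ℤ) ∈ Finset.image (fun i : Fin (n + 1) => a + (i : ℤ)) Finset.univ :=
    Finset.mem_image.2 ⟨i, Finset.mem_univ _, rfl⟩
  simp [boxRestrictAt, momentumReversalOn_apply_mem σ hi]

/-! ## Closure of the observable classes under the reversal of the box momenta -/

/-- Continuity is preserved by composing with the reversal of the box momenta. -/
theorem continuous_comp_boxRev {n : ℕ} {g : (Fin (n + 1) → ℝ × ℝ) → ℝ} (hg : Continuous g) :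
    Continuous fun y : Fin (n + 1) → ℝ × ℝ => g (fun i => ((y i).1, -(y i).2)) := by
  have h : (fun y : Fin (n + 1) → ℝ × ℝ => g (fun i => ((y i).1, -(y i).2))) =
      g ∘ fun (y : Fin (n + 1) → ℝ × ℝ) (i : Fin (n + 1)) => ((y i).1, -(y i).2) := rfl
  rw [h, boxRev_eq_coe]
  exact hg.comp (ContinuousLinearEquiv.continuous _)

/-- Polynomial bounds are preserved by composing with the reversal of the box momenta. -/
theorem polyBound_comp_boxRev {n : ℕ} {g : (Fin (n + 1) → ℝ × ℝ) → ℝ} {C₀ : ℝ} {m : ℕ}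
    (hg : ∀ y, |g y| ≤ C₀ * (1 + ‖y‖) ^ m) (y : Fin (n + 1) → ℝ × ℝ) :
    |g (fun i => ((y i).1, -(y i).2))| ≤ C₀ * (1 + ‖y‖) ^ m := by
  have h := hg (fun i => ((y i).1, -(y i).2))
  rwa [norm_boxRev] at h

/-- `C¹` is preserved by composing with the reversal of the box momenta. -/
theorem contDiff_comp_boxRev {n : ℕ} {G : (Fin (n + 1) → ℝ × ℝ) → ℝ} (hG : ContDiff ℝ 1 G) :
    ContDiff ℝ 1 fun y : Fin (n + 1) → ℝ × ℝ => G (fun i => ((y i).1, -(y i).2)) := by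
  have h : (fun y : Fin (n + 1) → ℝ × ℝ => G (fun i => ((y i).1, -(y i).2))) =
      G ∘ fun (y : Fin (n + 1) → ℝ × ℝ) (i : Fin (n + 1)) => ((y i).1, -(y i).2) := rfl
  rw [h, boxRev_eq_coe]
  exact hG.comp (ContinuousLinearEquiv.contDiff _)

/-- The derivative bound is preserved by composing with the reversal of the box momenta (chain rule;
the reversal has operator norm `≤ 1`). -/
theorem norm_fderiv_comp_boxRev_le {n : ℕ} {G : (Fin (n + 1) → ℝ × ℝ) → ℝ}
    (hG : ContDiff ℝ 1 G) {C₀ : ℝ} {m : ℕ}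
    (hd : ∀ y, ‖fderiv ℝ G y‖ ≤ C₀ * (1 + ‖y‖) ^ m) (y : Fin (n + 1) → ℝ × ℝ) :
    ‖fderiv ℝ (fun y : Fin (n + 1) → ℝ × ℝ => G (fun i => ((y i).1, -(y i).2))) y‖ ≤
      C₀ * (1 + ‖y‖) ^ m := by
  set E : (Fin (n + 1) → ℝ × ℝ) ≃L[ℝ] (Fin (n + 1) → ℝ × ℝ) :=
    ContinuousLinearEquiv.piCongrRight fun _ : Fin (n + 1) =>
      ContinuousLinearEquiv.prodCongr (ContinuousLinearEquiv.refl ℝ ℝ)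
        (ContinuousLinearEquiv.neg ℝ : ℝ ≃L[ℝ] ℝ) with hEdef
  have hE : (fun (y : Fin (n + 1) → ℝ × ℝ) (i : Fin (n + 1)) => ((y i).1, -(y i).2)) = ⇑E :=
    boxRev_eq_coe n
  have hEy : E y = fun i => ((y i).1, -(y i).2) := by rw [← hE]
  have hcomp : (fun y : Fin (n + 1) → ℝ × ℝ => G (fun i => ((y i).1, -(y i).2))) = G ∘ ⇑E := by
    rw [← hE]; rfl
  have hop : ‖(E : (Fin (n + 1) → ℝ × ℝ) →L[ℝ] (Fin (n + 1) → ℝ × ℝ))‖ ≤ 1 :=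
    ContinuousLinearMap.opNorm_le_bound _ zero_le_one fun z => by
      rw [one_mul, ContinuousLinearEquiv.coe_coe, ← hE, norm_boxRev]
  have hGd : DifferentiableAt ℝ G (E y) := (hG.differentiable one_ne_zero).differentiableAt
  have h1 : ‖fderiv ℝ G (E y)‖ ≤ C₀ * (1 + ‖y‖) ^ m := by
    have h := hd (E y)
    rwa [hEy, norm_boxRev] at h
  have hC : 0 ≤ C₀ * (1 + ‖y‖) ^ m := (norm_nonneg _).trans h1
  rw [hcomp, fderiv_comp y hGd (ContinuousLinearEquiv.differentiableAt _), ContinuousLinearEquiv.fderiv]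
  calc ‖(fderiv ℝ G (E y)).comp (E : (Fin (n + 1) → ℝ × ℝ) →L[ℝ] (Fin (n + 1) → ℝ × ℝ))‖
        ≤ ‖fderiv ℝ G (E y)‖ * ‖(E : (Fin (n + 1) → ℝ × ℝ) →L[ℝ] (Fin (n + 1) → ℝ × ℝ))‖ :=
          ContinuousLinearMap.opNorm_comp_le _ _
    _ ≤ C₀ * (1 + ‖y‖) ^ m * 1 := mul_le_mul h1 hop (norm_nonneg _) hC
    _ = C₀ * (1 + ‖y‖) ^ m := mul_one _

/-! ## The odd part of a functional -/

/-- **Odd reduction.** Let `μ` be a DLR Gibbs state of the chain `P` and `Λ` a functional on observables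
of the infinite chain which is (1) linear on continuous polynomially bounded cylinder observables,
(2) translation-uniformly `L²(μ)`-bounded on boxes and (3) annihilates the Liouville derivative of every
`C¹` polynomially bounded cylinder observable. Then its ODD PART under momentum reversal,
`Λ⁻ f = (Λ f - Λ (f ∘ R)) / 2`, is odd, satisfies (1)–(3) with the same constants, and coincides with
`Λ` on every cylinder observable that is odd under the reversal of the box momenta. Ingredients: `R`
preserves every DLR state on finite sets of sites (`IsChainGibbsMeasure.map_momentumReversalOn`), and
`𝒜(f ∘ R) = -(𝒜f) ∘ R` (`liouvilleZ_comp_momentumReversalZ`). -/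
theorem oddPart_spec : ∀ (P : OscillatorChain) {T : ℝ} {μ : Measure ChainConfig},
    P.IsChainGibbsMeasure T μ → ∀ (Λ : (ChainConfig → ℝ) → ℝ),
    (∀ (a : ℤ) (n : ℕ) (c₁ c₂ : ℝ) (g₁ g₂ : (Fin (n + 1) → ℝ × ℝ) → ℝ), Continuous g₁ →
      Continuous g₂ →
      (∃ (C₀ : ℝ) (m : ℕ), ∀ y, |g₁ y| ≤ C₀ * (1 + ‖y‖) ^ m ∧ |g₂ y| ≤ C₀ * (1 + ‖y‖) ^ m) →
      Λ ((fun y => c₁ * g₁ y + c₂ * g₂ y) ∘ boxRestrictAt a n) =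
        c₁ * Λ (g₁ ∘ boxRestrictAt a n) + c₂ * Λ (g₂ ∘ boxRestrictAt a n)) →
    (∀ n : ℕ, ∃ A : ℝ, ∀ (a : ℤ) (g : (Fin (n + 1) → ℝ × ℝ) → ℝ), Continuous g →
      (∃ (C₀ : ℝ) (m : ℕ), ∀ y, |g y| ≤ C₀ * (1 + ‖y‖) ^ m) →
      |Λ (g ∘ boxRestrictAt a n)| ≤ A * Real.sqrt (∫ σ, (g (boxRestrictAt a n σ)) ^ 2 ∂μ)) →
    (∀ (a : ℤ) (n : ℕ) (G : (Fin (n + 1) → ℝ × ℝ) → ℝ), ContDiff ℝ 1 G →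
      (∃ (C₀ : ℝ) (m : ℕ), ∀ y, |G y| ≤ C₀ * (1 + ‖y‖) ^ m ∧ ‖fderiv ℝ G y‖ ≤ C₀ * (1 + ‖y‖) ^ m) →
      Λ (liouvilleZ P (G ∘ boxRestrictAt a n)) = 0) →
    (∀ f : ChainConfig → ℝ,
      (fun f : ChainConfig → ℝ => (Λ f - Λ (f ∘ momentumReversalZ)) / 2) (f ∘ momentumReversalZ) =
        -(fun f : ChainConfig → ℝ => (Λ f - Λ (f ∘ momentumReversalZ)) / 2) f) ∧
    (∀ (a : ℤ) (n : ℕ) (c₁ c₂ : ℝ) (g₁ g₂ : (Fin (n + 1) → ℝ × ℝ) → ℝ), Continuous g₁ →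
      Continuous g₂ →
      (∃ (C₀ : ℝ) (m : ℕ), ∀ y, |g₁ y| ≤ C₀ * (1 + ‖y‖) ^ m ∧ |g₂ y| ≤ C₀ * (1 + ‖y‖) ^ m) →
      (fun f : ChainConfig → ℝ => (Λ f - Λ (f ∘ momentumReversalZ)) / 2)
          ((fun y => c₁ * g₁ y + c₂ * g₂ y) ∘ boxRestrictAt a n) =
        c₁ * (fun f : ChainConfig → ℝ => (Λ f - Λ (f ∘ momentumReversalZ)) / 2)
            (g₁ ∘ boxRestrictAt a n) +
          c₂ * (fun f : ChainConfig → ℝ => (Λ f - Λ (f ∘ momentumReversalZ)) / 2)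
            (g₂ ∘ boxRestrictAt a n)) ∧
    (∀ n : ℕ, ∃ A : ℝ, ∀ (a : ℤ) (g : (Fin (n + 1) → ℝ × ℝ) → ℝ), Continuous g →
      (∃ (C₀ : ℝ) (m : ℕ), ∀ y, |g y| ≤ C₀ * (1 + ‖y‖) ^ m) →
      |(fun f : ChainConfig → ℝ => (Λ f - Λ (f ∘ momentumReversalZ)) / 2) (g ∘ boxRestrictAt a n)| ≤
        A * Real.sqrt (∫ σ, (g (boxRestrictAt a n σ)) ^ 2 ∂μ)) ∧
    (∀ (a : ℤ) (n : ℕ) (G : (Fin (n + 1) → ℝ × ℝ) → ℝ), ContDiff ℝ 1 G →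
      (∃ (C₀ : ℝ) (m : ℕ), ∀ y, |G y| ≤ C₀ * (1 + ‖y‖) ^ m ∧ ‖fderiv ℝ G y‖ ≤ C₀ * (1 + ‖y‖) ^ m) →
      (fun f : ChainConfig → ℝ => (Λ f - Λ (f ∘ momentumReversalZ)) / 2)
          (liouvilleZ P (G ∘ boxRestrictAt a n)) = 0) ∧
    (∀ (a : ℤ) (n : ℕ) (g : (Fin (n + 1) → ℝ × ℝ) → ℝ), Continuous g →
      (∃ (C₀ : ℝ) (m : ℕ), ∀ y, |g y| ≤ C₀ * (1 + ‖y‖) ^ m) →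
      (∀ y, g (fun i => ((y i).1, -(y i).2)) = -g y) →
      (fun f : ChainConfig → ℝ => (Λ f - Λ (f ∘ momentumReversalZ)) / 2) (g ∘ boxRestrictAt a n) =
        Λ (g ∘ boxRestrictAt a n)) := by
  intro P T μ hμ Λ hlin hbd hinv
  -- `R` is an involution on observables
  have hRR : ∀ f : ChainConfig → ℝ, (f ∘ momentumReversalZ) ∘ momentumReversalZ = f := by
    intro f; funext σ
    simp only [Function.comp_apply]
    congr 1
    funext x; simp
  -- negation of a cylinder observable through linearity
  have hneg : ∀ (a : ℤ) (n : ℕ) (g : (Fin (n + 1) → ℝ × ℝ) → ℝ), Continuous g →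
      (∃ (C₀ : ℝ) (m : ℕ), ∀ y, |g y| ≤ C₀ * (1 + ‖y‖) ^ m) →
      Λ ((fun y => -g y) ∘ boxRestrictAt a n) = -Λ (g ∘ boxRestrictAt a n) := by
    intro a n g hg hb
    obtain ⟨C₀, m, hC⟩ := hb
    have h := hlin a n (-1) 0 g g hg hg ⟨C₀, m, fun y => ⟨hC y, hC y⟩⟩
    have hfun : (fun y => (-1 : ℝ) * g y + 0 * g y) = fun y => -g y := by
      funext y; ring
    rw [hfun] at h
    rw [h]; ring
  refine ⟨?_, ?_, ?_, ?_, ?_⟩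
  · -- oddness
    intro f
    simp only [hRR]
    ring
  · -- linearity
    intro a n c₁ c₂ g₁ g₂ hg₁ hg₂ hb
    obtain ⟨C₀, m, hC⟩ := hb
    have h1 := hlin a n c₁ c₂ g₁ g₂ hg₁ hg₂ ⟨C₀, m, hC⟩
    have h2 := hlin a n c₁ c₂ (fun y => g₁ (fun i => ((y i).1, -(y i).2)))
      (fun y => g₂ (fun i => ((y i).1, -(y i).2))) (continuous_comp_boxRev hg₁)
      (continuous_comp_boxRev hg₂)
      ⟨C₀, m, fun y => ⟨polyBound_comp_boxRev (fun y => (hC y).1) y,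
        polyBound_comp_boxRev (fun y => (hC y).2) y⟩⟩
    simp only []
    rw [comp_boxRestrictAt_comp_momentumReversalZ, comp_boxRestrictAt_comp_momentumReversalZ,
      comp_boxRestrictAt_comp_momentumReversalZ, h1, h2]
    ring
  · -- translation-uniform L² bound, same constant
    intro n
    obtain ⟨A, hA⟩ := hbd n
    refine ⟨A, fun a g hg hb => ?_⟩
    obtain ⟨C₀, m, hC⟩ := hb
    have h1 := hA a g hg ⟨C₀, m, hC⟩
    have h2 := hA a (fun y => g (fun i => ((y i).1, -(y i).2))) (continuous_comp_boxRev hg)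
      ⟨C₀, m, polyBound_comp_boxRev hC⟩
    -- the Gibbs state is invariant under the reversal of the box momenta
    have hint : ∫ σ, (g (fun i => ((boxRestrictAt a n σ i).1, -(boxRestrictAt a n σ i).2))) ^ 2 ∂μ =
        ∫ σ, (g (boxRestrictAt a n σ)) ^ 2 ∂μ := by
      have hS := hμ.map_momentumReversalOn (Finset.image (fun i : Fin (n + 1) => a + (i : ℤ)) Finset.univ)
      have h := integral_comp_momentumReversalOn
        (Finset.image (fun i : Fin (n + 1) => a + (i : ℤ)) Finset.univ) μ
        (fun σ => (g (boxRestrictAt a n σ)) ^ 2)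
      rw [hS] at h
      simp only [boxRestrictAt_momentumReversalOn_eq] at h
      exact h
    rw [hint] at h2
    simp only []
    rw [comp_boxRestrictAt_comp_momentumReversalZ]
    rw [abs_le] at h1 h2 ⊢
    constructor <;> linarith [h1.1, h1.2, h2.1, h2.2]
  · -- invariance
    intro a n G hG hb
    obtain ⟨C₀, m, hC⟩ := hb
    have h1 := hinv a n G hG ⟨C₀, m, hC⟩
    -- `(𝒜F) ∘ R = -𝒜(F ∘ R) = 𝒜(-(F ∘ R))`, and `-(G ∘ r)` is again `C¹` polynomially bounded
    have h2 := hinv a n (fun y => -G (fun i => ((y i).1, -(y i).2))) (contDiff_comp_boxRev hG).neg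
      ⟨C₀, m, fun y => ⟨by simpa [abs_neg] using polyBound_comp_boxRev (fun y => (hC y).1) y, by
        rw [show (fun y : Fin (n + 1) → ℝ × ℝ => -G (fun i => ((y i).1, -(y i).2))) =
            -(fun y : Fin (n + 1) → ℝ × ℝ => G (fun i => ((y i).1, -(y i).2))) from rfl,
          fderiv_neg, norm_neg]
        exact norm_fderiv_comp_boxRev_le hG (fun y => (hC y).2) y⟩⟩
    have hcomp : liouvilleZ P (G ∘ boxRestrictAt a n) ∘ momentumReversalZ =
        liouvilleZ P ((fun y => -G (fun i => ((y i).1, -(y i).2))) ∘ boxRestrictAt a n) := by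
      have hf : ((fun y => -G (fun i => ((y i).1, -(y i).2))) ∘ boxRestrictAt a n) =
          fun σ => -(((G ∘ boxRestrictAt a n) ∘ momentumReversalZ) σ) := by
        rw [comp_boxRestrictAt_comp_momentumReversalZ]
        rfl
      rw [hf]
      funext σ
      -- `𝒜(F ∘ R) = -(𝒜F) ∘ R` and `𝒜(-f) = -𝒜f` pointwise (no differentiability needed)
      have h := liouvilleZ_comp_momentumReversalZ P (G ∘ boxRestrictAt a n) σ
      have hn : liouvilleZ P (fun σ => -(((G ∘ boxRestrictAt a n) ∘ momentumReversalZ) σ)) σ =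
          -liouvilleZ P ((G ∘ boxRestrictAt a n) ∘ momentumReversalZ) σ := by
        simp only [liouvilleZ, partialQZ, partialPZ, deriv.fun_neg, mul_neg, ← tsum_neg, neg_add]
      rw [Function.comp_apply, hn, h, neg_neg]
    simp only []
    rw [hcomp, h1, h2]
    norm_num
  · -- odd cylinder observables are fixed
    intro a n g hg hb hodd
    simp only []
    rw [comp_boxRestrictAt_comp_momentumReversalZ]
    have hfun : (fun y : Fin (n + 1) → ℝ × ℝ => g (fun i => ((y i).1, -(y i).2))) = fun y => -g y :=
      funext fun y => hodd y
    rw [hfun, hneg a n g hg hb]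
    ring

/-! ## The bond current of the pinned anharmonic chain as an odd cylinder observable -/

/-- The bond current `j_x` of the pinned anharmonic chain is the cylinder observable
`g ∘ boxRestrictAt x 1` with `g(y) = -((p₀ + p₁)/2) (r + β r³)`, `r = q₁ - q₀` (`pinnedChain_deriv_V`). -/
theorem bondCurrentZ_pinnedChain_eq_comp_boxRestrictAt (ω₂ lam β γ : ℝ) (x : ℤ) :
    (fun σ => (pinnedChain ω₂ lam β γ).bondCurrentZ σ x) =
      (fun y : Fin (1 + 1) → ℝ × ℝ =>
        -(((y 0).2 + (y 1).2) / 2 * (((y 1).1 - (y 0).1) + β * ((y 1).1 - (y 0).1) ^ 3))) ∘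
        boxRestrictAt x 1 := by
  funext σ
  simp only [Function.comp_apply, OscillatorChain.bondCurrentZ, pinnedChain_deriv_V, boxRestrictAt,
    Fin.val_zero, Nat.cast_zero, add_zero, Fin.val_one, Nat.cast_one]

/-- The window function of the bond current is continuous. -/
theorem continuous_bondCurrentWindow (β : ℝ) :
    Continuous fun y : Fin (1 + 1) → ℝ × ℝ =>
      -(((y 0).2 + (y 1).2) / 2 * (((y 1).1 - (y 0).1) + β * ((y 1).1 - (y 0).1) ^ 3)) := by
  fun_prop

/-- The window function of the bond current is polynomially bounded: `|g y| ≤ (2 + 8|β|)(1 + ‖y‖)⁴`. -/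
theorem polyBound_bondCurrentWindow (β : ℝ) (y : Fin (1 + 1) → ℝ × ℝ) :
    |(-(((y 0).2 + (y 1).2) / 2 * (((y 1).1 - (y 0).1) + β * ((y 1).1 - (y 0).1) ^ 3)))| ≤
      (2 + 8 * |β|) * (1 + ‖y‖) ^ 4 := by
  set s := ‖y‖ with hs
  have hs0 : 0 ≤ s := norm_nonneg _
  have hq0 : |(y 0).1| ≤ s := (norm_fst_le (y 0)).trans (norm_le_pi_norm y 0)
  have hq1 : |(y 1).1| ≤ s := (norm_fst_le (y 1)).trans (norm_le_pi_norm y 1)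
  have hp0 : |(y 0).2| ≤ s := (norm_snd_le (y 0)).trans (norm_le_pi_norm y 0)
  have hp1 : |(y 1).2| ≤ s := (norm_snd_le (y 1)).trans (norm_le_pi_norm y 1)
  have hP : |((y 0).2 + (y 1).2) / 2| ≤ s := by
    rw [abs_div, abs_two]
    have := abs_add_le (y 0).2 (y 1).2
    linarith
  have hr : |(y 1).1 - (y 0).1| ≤ 2 * s := by
    have := abs_sub (y 1).1 (y 0).1
    linarith
  have hr3 : |((y 1).1 - (y 0).1) ^ 3| ≤ (2 * s) ^ 3 := by
    rw [abs_pow]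
    exact pow_le_pow_left₀ (abs_nonneg _) hr 3
  have hF : |((y 1).1 - (y 0).1) + β * ((y 1).1 - (y 0).1) ^ 3| ≤ 2 * s + |β| * (2 * s) ^ 3 := by
    calc |((y 1).1 - (y 0).1) + β * ((y 1).1 - (y 0).1) ^ 3|
          ≤ |(y 1).1 - (y 0).1| + |β * ((y 1).1 - (y 0).1) ^ 3| := abs_add_le _ _
      _ = |(y 1).1 - (y 0).1| + |β| * |((y 1).1 - (y 0).1) ^ 3| := by rw [abs_mul]
      _ ≤ 2 * s + |β| * (2 * s) ^ 3 := by
          gcongr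
  rw [abs_neg, abs_mul]
  have hβ0 : 0 ≤ |β| := abs_nonneg β
  calc |((y 0).2 + (y 1).2) / 2| * |((y 1).1 - (y 0).1) + β * ((y 1).1 - (y 0).1) ^ 3|
        ≤ s * (2 * s + |β| * (2 * s) ^ 3) :=
          mul_le_mul hP hF (abs_nonneg _) hs0
    _ ≤ (2 + 8 * |β|) * (1 + s) ^ 4 := by
          have h1 : s ≤ 1 + s := by linarith
          have h2 : s * s ≤ (1 + s) ^ 4 := by
            nlinarith [pow_le_pow_left₀ hs0 h1 2, pow_le_pow_left₀ hs0 h1 4]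
          have h3 : s ^ 4 ≤ (1 + s) ^ 4 := pow_le_pow_left₀ hs0 h1 4
          nlinarith [h2, h3, hβ0, hs0]

/-- The window function of the bond current is odd under the reversal of the box momenta. -/
theorem bondCurrentWindow_boxRev (β : ℝ) (y : Fin (1 + 1) → ℝ × ℝ) :
    (fun y : Fin (1 + 1) → ℝ × ℝ =>
        -(((y 0).2 + (y 1).2) / 2 * (((y 1).1 - (y 0).1) + β * ((y 1).1 - (y 0).1) ^ 3)))
        (fun i => ((y i).1, -(y i).2)) =
      -(fun y : Fin (1 + 1) → ℝ × ℝ =>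
        -(((y 0).2 + (y 1).2) / 2 * (((y 1).1 - (y 0).1) + β * ((y 1).1 - (y 0).1) ^ 3))) y := by
  simp only []
  ring

end Summit.AtomisticToContinuum.FouriersLaw.Theorems.LocalOhmBirth

end
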